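import Summits.BirchSwinnertonDyer.BirchSwinnertonDyer.Theorems.Rank1ResidualJetKolyvaginDecompositionTrivial
import Literature.NumberTheory.EllipticCurves.HeegnerPointsKolyvaginPrimaryCongruenceProofs
import Mathlib.FieldTheory.Finite.Basic
import HarnessLib

/-!
# T1 JET (cell `bsd-jet`), road K, input (L1) — brick D: a lift of complex conjugation which
# STABILISES a prime `𝔓 ∣ λ` acts on `E[p^k](K̄)` as the `ℚ`-Frobenius at `ℓ`, hence as a
# BALANCED involution (`#ker(τ̃_* ∓ 1) = p^k`)

HONEST FRAMING (programme file `BSD-LIT2PART-PROGRAMME-v1.md` §HONESTY, verbatim): «no tranche here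
proves BSD; ARM L moves the LITERAL column of an r ≤ 1 census into the kernel-proved-modulo-named-print
column; ARM P changes what «named print» is worth.» THEOREMS ONLY (seat `bsd-jet-pv-1`, session g6;
`--supports stmt-BirchSwinnertonDyer-14418`, helper): no definition, no named fact, no `sorry`.
Nothing is booked; 0 classes move.

## What

`K` imaginary quadratic with non-trivial automorphism `τ`, `E = W/ℚ` globally minimal, `p` odd,
`1 ≤ k ≤ M(ℓ)` for a Kolyvagin prime `ℓ` of W. Zhang, `w = λ ∋ ℓ` (inert), `𝔓 ∣ w` a prime of
`\bar ℤ_K`, `𝔓' = 𝔓 ∩ \bar ℤ`.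
* `not_mem_range_absGaloisRestrict_of_isArithFrobAt` — **a `ℚ`-Frobenius `h'` at `𝔓'` does not
  fix `K`**: otherwise `h' = res g`, `g ∈ Γ_K`, acts on `\bar ℤ_K / 𝔓` as `x ↦ x^ℓ` AND fixes
  `𝓞_K`, so `a^ℓ ≡ a (mod λ)` on the residue field `𝓞_K/λ` of `ℓ²` elements — more roots than
  the degree of `X^ℓ − X`;
* `isLiftOfAut_absGaloisTransport_of_isArithFrobAt` — hence its transport `e h' e⁻¹` to `K̄` LIFTS
  `τ` ("`Frob_ℓ|_K = τ`": `ℓ` is inert);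
* **`natCard_ker_torsionMap_sub_smul_eq_pow`** — for ANY lift `t` of `τ` to `K̄` whose transport
  `γ ∈ Γ_ℚ` (`t = e γ e⁻¹`) stabilises `𝔓'`: `#ker(t_* − s | E[p^k](K̄)) = p^k` for `s = ±1`.
  Proof: `g₀ = h'⁻¹ γ` fixes `K` (both lift `τ`), so `g₀ = res g₁` with `g₁ ∈ G_𝔓`, which fixes
  `E[p^k](K̄)` (brick C); thus `γ = h'` on `E[p^k](ℚ̄)`, a balanced involution (brick B), and
  `E[p^k](ℚ̄) ≃ E[p^k](K̄)` intertwines `γ` with `t_*` (`RatClosure.torsionEquiv_smul_of_lift`).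
Consumer: `t = liftAutPlace τ hfix` (the lift inside `conjActPlace`), which stabilises
`𝔓₀ = adicCompletionPrime K λ` (brick F), giving `hloc`.

References (locators only; no cited FACT is declared): [cite: GrossLMS1991, §3 (3.1)–(3.4)]
[cite: Jetchev2008, §3.2 (2) (p. 815)] [cite: NeukirchANT1999, Ch. I §8 (8.3), §9 Prop. (9.4)]
[cite: WZhang2014, Notations (xii)]. Design: no definitions; `K : Type`. Axioms: `propext`,
`Classical.choice`, `Quot.sound`.
-/

set_option autoImplicit false

noncomputable section

open scoped Classical Pointwise NumberField
open WeierstrassCurve Field Function NumberField IsDedekindDomain Rat.HeightOneSpectrum Polynomial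
open Literature.NumberTheory.EllipticCurves Literature.NumberTheory.GaloisRepresentations
open Summit.BirchSwinnertonDyer.Rank1Residual.X11b.Three.Koly.Method2

namespace Summit.BirchSwinnertonDyer.Rank1Residual.JET.GlobalDuality

section LiftBalanced

variable (W : WeierstrassCurve ℚ) (K : Type) [Field K] [NumberField K] [W.IsElliptic] [W.IsGloballyMinimal]

omit [W.IsElliptic] [W.IsGloballyMinimal] in
/-- In a field with more than `ℓ` elements (`ℓ ≥ 2`) not every element satisfies `x^ℓ = x`
(`X^ℓ − X` has at most `ℓ` roots). [folklore] -/
theorem exists_pow_ne_self_of_lt_card {F : Type*} [Field F] [Finite F] {ℓ : ℕ} (hℓ : 1 < ℓ)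
    (hcard : ℓ < Nat.card F) : ∃ x : F, x ^ ℓ ≠ x := by
  by_contra h
  have h' : ∀ x : F, x ^ ℓ = x := fun x => by
    by_contra hx; exact h ⟨x, hx⟩
  letI := Fintype.ofFinite F
  set f : F[X] := X ^ ℓ - X with hf
  have hf0 : f ≠ 0 := FiniteField.X_pow_card_sub_X_ne_zero F hℓ
  have hdeg : f.natDegree = ℓ := FiniteField.X_pow_card_sub_X_natDegree_eq F hℓ
  have hroots : (Finset.univ : Finset F).val ≤ f.roots := by
    rw [Finset.val_le_iff_val_subset]
    intro x _
    rw [mem_roots hf0, IsRoot.def, hf, eval_sub, eval_pow, eval_X, h', sub_self]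
  have hle := (Multiset.card_le_card hroots).trans (card_roots' f)
  rw [hdeg, Finset.card_val, Finset.card_univ, ← Nat.card_eq_fintype_card] at hle
  exact absurd hcard (not_lt.mpr hle)

omit [W.IsElliptic] [W.IsGloballyMinimal] in
/-- The residue field of a quadratic field at an inert rational prime `ℓ` (`(ℓ)` prime in `𝓞 K`)
has `ℓ²` elements. [cite: NeukirchANT1999, Ch. I §8 (8.3)] -/
theorem natCard_quotient_eq_sq_of_inert (hK2 : Module.finrank ℚ K = 2) {ℓ : ℕ} (hℓ : ℓ.Prime)
    (hℓP : (Ideal.span {(ℓ : 𝓞 K)}).IsPrime) {w : HeightOneSpectrum (𝓞 K)}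
    (hw : (ℓ : 𝓞 K) ∈ w.asIdeal) : Nat.card (𝓞 K ⧸ w.asIdeal) = ℓ ^ 2 := by
  have hne : Ideal.span {(ℓ : 𝓞 K)} ≠ ⊥ := by
    rw [Ne, Ideal.span_singleton_eq_bot]; exact_mod_cast hℓ.ne_zero
  have heq : Ideal.span {(ℓ : 𝓞 K)} = w.asIdeal :=
    (hℓP.isMaximal hne).eq_of_le w.isPrime.ne_top ((Ideal.span_singleton_le_iff_mem _).mpr hw)
  rw [← HeightOneSpectrum.residueCard_eq_card_quotient, HeightOneSpectrum.residueCard, ← heq,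
    Ideal.absNorm_span_natCast, NumberField.RingOfIntegers.rank, hK2]

omit [W.IsElliptic] [W.IsGloballyMinimal] in
/-- **A `ℚ`-Frobenius above an inert prime of a quadratic field does not fix the field.** Let
`[K : ℚ] = 2`, `ℓ` inert, `w ∋ ℓ`, `𝔓 ∣ w` a prime of `\bar ℤ_K`, `𝔓' = 𝔓 ∩ \bar ℤ`, and `h'` an
arithmetic Frobenius at `𝔓'`. Then `h'` is not the restriction of an element of `Γ_K`: such a `g`
would act on `\bar ℤ_K/𝔓` as `x ↦ x^ℓ` and fix `𝓞_K`, forcing `a^ℓ ≡ a (mod λ)` on the field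
`𝓞_K/λ` of `ℓ²` elements. [cite: NeukirchANT1999, Ch. I §9 Prop. (9.4)] -/
theorem not_mem_range_absGaloisRestrict_of_isArithFrobAt (hK2 : Module.finrank ℚ K = 2) {ℓ : ℕ}
    (hℓ : ℓ.Prime) (hℓP : (Ideal.span {(ℓ : 𝓞 K)}).IsPrime) {w : HeightOneSpectrum (𝓞 K)}
    (hw : (ℓ : 𝓞 K) ∈ w.asIdeal) {𝔓 : Ideal (absIntegers (𝓞 K) K)} (h𝔓 : 𝔓 ∈ w.primesAbove)
    {v : HeightOneSpectrum (𝓞 ℚ)} (hv : (ℓ : 𝓞 ℚ) ∈ v.asIdeal)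
    (h𝔓' : 𝔓.comap (absIntegersMap ℚ K) ∈ v.primesAbove)
    {h' : absoluteGaloisGroup ℚ} (hh' : IsArithFrobAt (𝓞 ℚ) h' (𝔓.comap (absIntegersMap ℚ K))) :
    h' ∉ Set.range (absGaloisRestrict ℚ K) := by
  rintro ⟨g, rfl⟩
  haveI : (𝔓.comap (absIntegersMap ℚ K)).IsPrime := h𝔓'.1
  -- `res g • x ≡ x^ℓ` on `\bar ℤ`, hence `g • z ≡ z^ℓ` on `\bar ℤ_K` modulo `𝔓`
  have h1 : ∀ x : absIntegers (𝓞 ℚ) ℚ,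
      absGaloisRestrict ℚ K g • x - x ^ ℓ ∈ 𝔓.comap (absIntegersMap ℚ K) := fun x => by
    have := hh' x
    rwa [MulSemiringAction.toAlgHom_apply, HeightOneSpectrum.card_quotient_under_eq_residueCard h𝔓',
      residueCard_eq_of_natCast_mem_rat hℓ hv] at this
  have h2 := (forall_smul_sub_pow_mem_comap_iff ℚ K 𝔓 g ℓ).mp h1
  -- `g` fixes `𝓞_K`: every `a ∈ 𝓞 K` satisfies `a − a^ℓ ∈ λ`
  have h3 : ∀ a : 𝓞 K, a - a ^ ℓ ∈ w.asIdeal := fun a => by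
    have hz := h2 (algebraMap (𝓞 K) (absIntegers (𝓞 K) K) a)
    have hfix : g • algebraMap (𝓞 K) (absIntegers (𝓞 K) K) a = algebraMap (𝓞 K) _ a := by
      apply Subtype.ext
      rw [integralClosure.coe_smul]
      change g • algebraMap K (AlgebraicClosure K) (a : K) = algebraMap K (AlgebraicClosure K) (a : K)
      rw [absoluteGaloisGroup.smul_def, AlgEquiv.commutes]
    rw [hfix, ← map_pow, ← map_sub] at hz
    have hz' : a - a ^ ℓ ∈ 𝔓.under (𝓞 K) := by rw [Ideal.under_def, Ideal.mem_comap]; exact hz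
    rwa [← h𝔓.2.over] at hz'
  -- contradiction in the residue field `𝓞 K ⧸ λ` of `ℓ²` elements
  haveI : w.asIdeal.IsMaximal := w.isPrime.isMaximal w.ne_bot
  letI : Field (𝓞 K ⧸ w.asIdeal) := Ideal.Quotient.field w.asIdeal
  haveI : Finite (𝓞 K ⧸ w.asIdeal) := Ideal.finiteQuotientOfFreeOfNeBot w.asIdeal w.ne_bot
  have hcard : Nat.card (𝓞 K ⧸ w.asIdeal) = ℓ ^ 2 := natCard_quotient_eq_sq_of_inert K hK2 hℓ hℓP hw
  obtain ⟨x, hx⟩ := exists_pow_ne_self_of_lt_card (F := 𝓞 K ⧸ w.asIdeal) hℓ.one_lt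
    (by rw [hcard, pow_two]; exact lt_mul_of_one_lt_right hℓ.pos hℓ.one_lt)
  obtain ⟨a, rfl⟩ := Ideal.Quotient.mk_surjective x
  apply hx
  rw [← map_pow, eq_comm, Ideal.Quotient.mk_eq_mk_iff_sub_mem]
  exact h3 a

omit [W.IsElliptic] [W.IsGloballyMinimal] in
/-- **"`Frob_ℓ|_K = τ`"**: for `K` imaginary quadratic with non-trivial automorphism `τ` and `h'`
a `ℚ`-Frobenius at `𝔓' = 𝔓 ∩ \bar ℤ` above an inert `ℓ`, the transport `e h' e⁻¹` of `h'` to `K̄`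
lifts `τ` (`Aut(K/ℚ)` has two elements; the restriction of `e h' e⁻¹` to `K` is not `1` by
`not_mem_range_absGaloisRestrict_of_isArithFrobAt`). Gross 1991 §3: "Frob(ℓ) = τ in Gal(K/ℚ);
hence `(ℓ)` remains inert". [cite: GrossLMS1991, §3 (after (3.2))]
[cite: NeukirchANT1999, Ch. I §9 Prop. (9.4)] -/
theorem isLiftOfAut_absGaloisTransport_of_isArithFrobAt (hK : IsImaginaryQuadratic K) {τ : K ≃ₐ[ℚ] K}
    (hτ1 : τ ≠ 1) {ℓ : ℕ} (hℓ : ℓ.Prime) (hℓP : (Ideal.span {(ℓ : 𝓞 K)}).IsPrime)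
    {w : HeightOneSpectrum (𝓞 K)} (hw : (ℓ : 𝓞 K) ∈ w.asIdeal)
    {𝔓 : Ideal (absIntegers (𝓞 K) K)} (h𝔓 : 𝔓 ∈ w.primesAbove)
    {v : HeightOneSpectrum (𝓞 ℚ)} (hv : (ℓ : 𝓞 ℚ) ∈ v.asIdeal)
    (h𝔓' : 𝔓.comap (absIntegersMap ℚ K) ∈ v.primesAbove)
    {h' : absoluteGaloisGroup ℚ} (hh' : IsArithFrobAt (𝓞 ℚ) h' (𝔓.comap (absIntegersMap ℚ K))) :
    IsLiftOfAut τ (absGaloisTransport (K := ℚ) (L := K) h').toRingEquiv := by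
  haveI : Algebra.IsQuadraticExtension ℚ K := ⟨hK.1⟩
  have hcard : Nat.card (K ≃ₐ[ℚ] K) = 2 := by rw [IsGalois.card_aut_eq_finrank, hK.1]
  obtain ⟨y, -, hy⟩ := (Nat.card_eq_two_iff' (1 : K ≃ₐ[ℚ] K)).mp hcard
  have hne : (absGaloisTransport (K := ℚ) (L := K) h').restrictNormal K ≠ 1 := by
    intro h1
    apply not_mem_range_absGaloisRestrict_of_isArithFrobAt K hK.1 hℓ hℓP hw h𝔓 hv h𝔓' hh'
    rw [mem_range_absGaloisRestrict_iff]
    intro x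
    have h := AlgEquiv.restrictNormal_commutes (absGaloisTransport (K := ℚ) (L := K) h') K x
    rw [h1, AlgEquiv.one_apply] at h
    exact h.symm
  rw [hy τ hτ1, ← hy _ hne]
  exact RatClosure.isLiftOfAut_restrictNormal_absGaloisTransport h'

/-- **A lift of `τ` stabilising `𝔓' = 𝔓 ∩ \bar ℤ` acts on `E[p^k](K̄)` as a balanced involution.**
`K` imaginary quadratic, `τ ≠ 1`, `p` odd, `1 ≤ k ≤ M(ℓ)` for a Zhang–Kolyvagin prime `ℓ`, `w ∋ ℓ`,
`𝔓 ∣ w`; `t` a lift of `τ` to `K̄` with transport `γ ∈ Γ_ℚ` (`t = e γ e⁻¹`) in the decomposition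
group of `𝔓'`. Then `#ker(t_* − s | E[p^k](K̄)) = p^k` for `s = ±1`: `h'⁻¹γ = res g₁` with
`g₁ ∈ G_𝔓` trivial on `E[p^k](K̄)` (brick C), so `γ` acts on `E[p^k](ℚ̄)` as the Frobenius `h'`,
balanced by brick B, and `E[p^k](ℚ̄) ≃ E[p^k](K̄)` carries `γ` to `t_*`. Jetchev 2008 §3.2 (2):
`τ` acts on `E[p^k] ≅ H¹_f(K_λ, E[p^k])` with both eigenspaces free of rank one.
[cite: Jetchev2008, §3.2 (2) (p. 815)] [cite: GrossLMS1991, §3 (3.2)–(3.4)] -/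
theorem natCard_ker_torsionMap_sub_smul_eq_pow (hK : IsImaginaryQuadratic K) {p : ℕ} [Fact p.Prime]
    (hp2 : p ≠ 2) {k ℓ : ℕ} (hk1 : 1 ≤ k)
    (hℓ : Zhang2014.IsKolyvaginPrime (W.conductorNorm ℤ) W K p ℓ)
    (hk : k ≤ Zhang2014.kolyvaginIndex W p ℓ)
    (w : HeightOneSpectrum (𝓞 K)) (hw : (ℓ : 𝓞 K) ∈ w.asIdeal)
    {𝔓 : Ideal (absIntegers (𝓞 K) K)} (h𝔓 : 𝔓 ∈ w.primesAbove)
    {τ : K ≃ₐ[ℚ] K} (hτ1 : τ ≠ 1) {t : AlgebraicClosure K ≃+* AlgebraicClosure K} (ht : IsLiftOfAut τ t)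
    {γ : absoluteGaloisGroup ℚ} (hγ : ∀ x, t x = absGaloisTransport (K := ℚ) (L := K) γ x)
    (hγD : γ ∈ (𝔓.comap (absIntegersMap ℚ K)).decompositionSubgroup (absoluteGaloisGroup ℚ))
    {s : ℤ} (hs : s = 1 ∨ s = -1) :
    Nat.card (ht.torsionMap W ((p ^ k : ℕ) : ℤ) - s • AddMonoidHom.id _).ker = p ^ k := by
  have hp : p.Prime := Fact.out
  have hℓp : ℓ.Prime := hℓ.1
  have hℓp' : ℓ ≠ p := hℓ.2.2.2.1
  have hℓP : (Ideal.span {(ℓ : 𝓞 K)}).IsPrime := hℓ.2.2.2.2.1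
  obtain ⟨h1, ha⟩ := (Zhang2014.le_kolyvaginIndex_iff (W := W) (p := p)).mp hk
  set n : ℤ := ((p ^ k : ℕ) : ℤ) with hn
  -- ### the place `v₁` of `ℚ` below `w`, the prime `𝔓'`, a Frobenius `h'`
  set v₁ : HeightOneSpectrum (𝓞 ℚ) := w.under (𝓞 ℚ) with hv₁
  have hwv₁ : w.asIdeal.under (𝓞 ℚ) = v₁.asIdeal := rfl
  have hℓv₁ : (ℓ : 𝓞 ℚ) ∈ v₁.asIdeal := by
    rw [← hwv₁, Ideal.under_def, Ideal.mem_comap, map_natCast]; exact hw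
  have hv₁ℓ : (primesEquiv v₁ : ℕ) = ℓ := primesEquiv_eq_of_natCast_mem hℓp hℓv₁
  have hgood₁ : W.HasGoodReductionAt v₁ :=
    LocalFrob.hasGoodReductionAt_rat_of_not_dvd_conductorNorm W hℓp hℓ.2.1 v₁ hℓv₁
  set 𝔓' := 𝔓.comap (absIntegersMap ℚ K) with h𝔓'def
  have h𝔓' : 𝔓' ∈ v₁.primesAbove := comap_absIntegersMap_mem_primesAbove hwv₁ h𝔓
  haveI : 𝔓'.IsPrime := h𝔓'.1
  obtain ⟨h', hh'⟩ := HeightOneSpectrum.exists_isArithFrobAt_of_mem_primesAbove_holds h𝔓'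
  -- ### `h'` lifts `τ`; `g₀ = h'⁻¹ γ` fixes `K`, so `g₀ = res g₁` with `g₁ ∈ G_𝔓`
  have hlift : IsLiftOfAut τ (absGaloisTransport (K := ℚ) (L := K) h').toRingEquiv :=
    isLiftOfAut_absGaloisTransport_of_isArithFrobAt K hK hτ1 hℓp hℓP hw h𝔓 hℓv₁ h𝔓' hh'
  set g₀ : absoluteGaloisGroup ℚ := h'⁻¹ * γ with hg₀
  have hg₀K : g₀ ∈ Set.range (absGaloisRestrict ℚ K) := by
    rw [mem_range_absGaloisRestrict_iff]
    intro x
    rw [hg₀, map_mul, map_inv, AlgEquiv.mul_apply, ← hγ, ht x]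
    have hx : absGaloisTransport (K := ℚ) (L := K) h' (algebraMap K (AlgebraicClosure K) x) =
        algebraMap K (AlgebraicClosure K) (τ x) := hlift x
    rw [← hx, ← AlgEquiv.mul_apply, inv_mul_cancel, AlgEquiv.one_apply]
  obtain ⟨g₁, hg₁⟩ := hg₀K
  have hg₁D : g₁ ∈ 𝔓.decompositionSubgroup (absoluteGaloisGroup K) := by
    rw [← comap_decompositionSubgroup_comap_absIntegersMap ℚ K 𝔓, Subgroup.mem_comap]
    change absGaloisRestrict ℚ K g₁ ∈ 𝔓'.decompositionSubgroup (absoluteGaloisGroup ℚ)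
    rw [hg₁, hg₀]
    exact Subgroup.mul_mem _ (Subgroup.inv_mem _ hh'.mem_stabilizer) hγD
  -- `g₀` acts trivially on `E[p^k](ℚ̄)`
  have hg₀P : ∀ P : geomTorsion W n, g₀ • P = P := fun P => by
    apply (RatClosure.torsionEquiv (K := K) W n).injective
    rw [← hg₁, RatClosure.torsionEquiv_smul,
      smul_torsion_eq_self_of_mem_decompositionSubgroup W K hK hℓ hk w hw h𝔓 hg₁D]
  -- ### so `γ` acts on `E[p^k](ℚ̄)` as `h'`, a balanced involution (brick B)
  have hγP : ∀ P : geomTorsion W n, γ • P = h' • P := fun P => by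
    have e : γ = h' * g₀ := by rw [hg₀, mul_inv_cancel_left]
    rw [e, mul_smul, hg₀P]
  have hne : ((primesEquiv v₁ : Nat.Primes) : ℕ) ≠ p := by rw [hv₁ℓ]; exact hℓp'
  have h1' : p ^ k ∣ ((primesEquiv v₁ : Nat.Primes) : ℕ) + 1 := by rw [hv₁ℓ]; exact h1
  have ha' : ((p ^ k : ℕ) : ℤ) ∣ W.frobeniusTrace (primesEquiv v₁) := by
    rw [hv₁ℓ]; exact_mod_cast ha
  have hcount := natCard_ker_frob_sub_smul_id_eq_pow W p hp2 hk1 hne hgood₁ h1' ha'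
    ⟨𝔓', h𝔓', hh'⟩ hs
  -- ### transport along `E[p^k](ℚ̄) ≃ E[p^k](K̄)`, which carries `γ` to `t_*`
  rw [← hcount]
  symm
  refine Nat.card_congr ((RatClosure.torsionEquiv (K := K) W n).toEquiv.subtypeEquiv fun P => ?_)
  change P ∈ (DistribSMul.toAddMonoidHom (geomTorsion W n) h' - s • AddMonoidHom.id _).ker ↔
    RatClosure.torsionEquiv (K := K) W n P ∈ (ht.torsionMap W n - s • AddMonoidHom.id _).ker
  rw [AddMonoidHom.mem_ker, AddMonoidHom.mem_ker, AddMonoidHom.sub_apply, AddMonoidHom.sub_apply,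
    AddMonoidHom.smul_apply, AddMonoidHom.smul_apply, AddMonoidHom.id_apply, AddMonoidHom.id_apply,
    ← RatClosure.torsionEquiv_smul_of_lift W ht γ hγ n P, hγP, ← map_zsmul, ← map_sub,
    map_eq_zero_iff _ (RatClosure.torsionEquiv (K := K) W n).injective]
  rfl

end LiftBalanced

end Summit.BirchSwinnertonDyer.Rank1Residual.JET.GlobalDuality

end
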